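import Summits.ResolutionOfSingularities.ResolutionOfSingularities.Theses.UniformComplexity
import Summits.ResolutionOfSingularities.ResolutionOfSingularities.Theorems.UniversalCellsPrimeFieldToPerfectStubClimbAlgebraic
import Mathlib.FieldTheory.Finite.Basic
import Mathlib.FieldTheory.Perfect
import Mathlib.Algebra.CharP.Algebra
import HarnessLib

/-!
# `UniformComplexity.FiniteToClosure` (stmt-ResolutionOfSingularities-8947): finite fields ⇒ `𝔽̄_p`

Route `ResolutionOfSingularities/UniformComplexity`, support item `FiniteToClosure` (rank 9): for a
prime `p`, resolution of all integral separated finite-type schemes over all FINITE fields of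
characteristic `p` implies resolution of all integral separated finite-type schemes over every
algebraically closed field `k` of characteristic `p` that is algebraic over `𝔽_p` (every `x ∈ k`
satisfies `x^{p^n} = x` for some `n ≥ 1`, i.e. `k ≅ 𝔽̄_p`).

**Proof.** This is the algebraic case of the one-transcendental climb of crux `PrimeFieldToPerfect`
(route `UniversalCells`, stmt-ResolutionOfSingularities-15233), already a theorem of the tree:
`Theorems.PrimeFieldToPerfect.stub_climbAlgebraic` — for a PERFECT field `M` over which all
integral separated finite-type schemes have resolutions and an ALGEBRAIC extension `L/M`, all
integral separated finite-type `L`-schemes have resolutions (spread out to a finitely generated,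
hence finite and perfect, intermediate field; resolve there; regular over a perfect field is smooth;
smooth base change; EGA IV₃ 8.8.2, Stacks 056S). Take `M := ZMod p` (finite, hence perfect, of
characteristic `p`; the hypothesis applies to it) and `L := k`, which is an algebra over `ZMod p`
because `CharP k p`, and algebraic over it because every `x ∈ k` is a root of the non-zero
polynomial `X^{p^n} − X`. Algebraic closedness of `k` is not used.

## References

* A. Grothendieck, J. Dieudonné, EGA IV₃ (1966), 8.8.2, 8.10.5. [EGAIV3]
* The Stacks Project, Tag 056S.
-/

noncomputable section

set_option linter.dupNamespace false -- mandated namespace of this single-conjunct summit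

open CategoryTheory AlgebraicGeometry Polynomial

namespace Summit.ResolutionOfSingularities.ResolutionOfSingularities.Theorems

/-- **`FiniteToClosure` (stmt-ResolutionOfSingularities-8947).** For a prime `p`: if every
integral separated scheme of finite type over every finite field of characteristic `p` admits a
resolution of singularities, then so does every integral separated scheme of finite type over every
algebraically closed field `k` of characteristic `p` algebraic over `𝔽_p` (`∀ x, ∃ n ≥ 1,
x^{p^n} = x`). Corollary of `PrimeFieldToPerfect.stub_climbAlgebraic` with `M = ZMod p`, `L = k`.
[folklore] -/
theorem finiteToClosure_proof :
    Summit.ResolutionOfSingularities.ResolutionOfSingularities.Theses.UniformComplexity.FiniteToClosure := by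
  intro p hp h k _ _ _ halg Y f hs hl hq hY
  haveI : Fact p.Prime := ⟨hp⟩
  letI : Algebra (ZMod p) k := ZMod.algebra k p
  -- `k` is algebraic over the prime field: `x` is a root of `X ^ (p ^ n) - X ≠ 0`
  haveI : Algebra.IsAlgebraic (ZMod p) k := by
    refine ⟨fun x => ?_⟩
    obtain ⟨n, hn, hx⟩ := halg x
    refine ⟨Polynomial.X ^ p ^ n - Polynomial.X,
      FiniteField.X_pow_card_pow_sub_X_ne_zero (ZMod p) (Nat.pos_iff_ne_zero.mp hn) hp.one_lt, ?_⟩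
    simp [hx]
  -- the prime field is finite, hence perfect, and the hypothesis applies to it
  haveI : PerfectField (ZMod p) := PerfectField.ofFinite
  exact PrimeFieldToPerfect.stub_climbAlgebraic (ZMod p)
    (fun Z g hs' hl' hq' hZ => h (ZMod p) Z g hs' hl' hq' hZ) k Y f hs hl hq hY

end Summit.ResolutionOfSingularities.ResolutionOfSingularities.Theorems

end
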